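import Summits.QuantumFields.YangMills.Theorems.FluctuationComparisonRegPrIntLS2BetaResidualSubgroup
import Summits.QuantumFields.YangMills.Theorems.FluctuationComparisonRegPrIntLS2BetaResidualGaugeCentral
import Summits.QuantumFields.YangMills.Theorems.FluctuationComparisonRegPrIntLS2BetaSignedCombCount
import HarnessLib

/-!
# LINE g18-1 S2β LAPLACE — `hstab`: THE STABILISER OF ANY FINE FIELD UNDER THE (β″) ACTION IS A CENTRAL SHEET × `{1}`

Crux `stmt-QuantumFields-20520` (`…Theses.UnitScaleTilt.FluctuationComparisonRegPrIntL`).  The `hstab` row of w5-20520's LIMIT-INST (its GAP 3), assembled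
from the three halves now in the tree: px11 g9's group half ✓`…S2BetaResidualSubgroup.pivotAct_eq_self_iff` (the stabiliser splits: pivot factor `= 1`,
residual factor fixes `z` OFF the pivots) and ✓`…S2BetaResidualGaugeCentral.exists_central_isResidual_of_residual` (a residual `w` is a central constant
times a ROOTED transformation acting identically), and this seat's chart-side half ✓`…S2BetaSignedCombKill.eq_one_of_isResidual_of_gaugeAct_eq_on_combSet`
(a rooted transformation fixing `z` on the comb bonds is `1`) with ✓`…S2BetaSignedCombCount.iterCentralBond_not_mem_combSet` (comb bonds are not pivots).
Result `pivotAct_eq_self_iff_central`: `pivotAct (βₖ) (w, h) z = z ↔ h = 1 ∧ w ≡ c` central — for EVERY `z` (no genericity needed), so the stabiliser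
is the finite set `{±1} × {1}` and `hfix` is px11's ✓`pivotAct_const_sheet_eq_self`.
[cite: Balaban1985Variational, Thm 1 (10) p.279, (4) p.278; Balaban1987RG1, p.256 (three sentences after (0.21))]
-/

noncomputable section

open Literature.MathematicalPhysics.QuantumFieldTheory.Balaban1983to89
open Literature.MathematicalPhysics.QuantumFieldTheory.Balaban1983to89.T3ContinuumYM3Torus
open Literature.MathematicalPhysics.QuantumFieldTheory.Balaban1983to89.T3UnitLawDensityEML
open Literature.MathematicalPhysics.QuantumFieldTheory.Balaban1983to89.T3TiltDescent
open Literature.MathematicalPhysics.QuantumFieldTheory.Balaban1983to89.B15DeterminingSets (embIter)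
open Literature.MathematicalPhysics.QuantumFieldTheory.Balaban1983to89.B12GaugeOrbits021 (IsResidual)
open scoped Literature.MathematicalPhysics.QuantumFieldTheory.Balaban1983to89.T3OrbitAverage
open Summit.QuantumFields.YangMills.Theorems.FluctuationComparisonRegPrIntLWregChain (iterCentralBond iterCentralBond_injective)
open Summit.QuantumFields.YangMills.Theorems.FluctuationComparisonRegPrIntLS2BetaResidualGauge
open Summit.QuantumFields.YangMills.Theorems.FluctuationComparisonRegPrIntLS2BetaResidualSubgroup
open Summit.QuantumFields.YangMills.Theorems.FluctuationComparisonRegPrIntLS2BetaResidualGaugeCentral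
open Summit.QuantumFields.YangMills.Theorems.FluctuationComparisonRegPrIntLS2BetaSignedCombKill
open Summit.QuantumFields.YangMills.Theorems.FluctuationComparisonRegPrIntLS2BetaSignedCombCount

namespace Summit.QuantumFields.YangMills.Theorems.FluctuationComparisonRegPrIntLS2BetaPivotStabiliser

variable (F : T3Family) {J K : ℕ} (hJK : J ≤ K)

/-- ★★ **`hstab` — THE STABILISER OF ANY FINE FIELD UNDER THE (β″) ACTION OF `K₀ × SU(2)^{pivots}` IS `{central sheets} × {1}`**: for the pivots
`βₖ = iterCentralBond (K − J)` (standing range), every `(w, h) ∈ ↥(residualSubgroup F hJK) × SU(2)^{PBond⁽ᴷ⁻ᴶ⁾}` and EVERY fine field `z`,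
`pivotAct βₖ (w, h) z = z ↔ h = 1 ∧ w ≡ c` with `c` central (`= ±1`).  [cite: Balaban1985Variational, Thm 1 (10) p.279, (4) p.278; Balaban1987RG1, p.256] -/
theorem pivotAct_eq_self_iff_central (hk : K - J ≤ (F.P K).m + (F.P K).K)
    (k : residualSubgroup F hJK × (PBond (F.P K) (K - J) → Matrix.specialUnitaryGroup (Fin 2) ℂ))
    (z : GaugeField (F.P K) 0 (Matrix.specialUnitaryGroup (Fin 2) ℂ)) :
    pivotAct F hJK (iterCentralBond (P := F.P K) (K - J)) k z = z ↔
      k.2 = 1 ∧ ∃ c : Matrix.specialUnitaryGroup (Fin 2) ℂ, (∀ g : Matrix.specialUnitaryGroup (Fin 2) ℂ, c * g = g * c) ∧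
        (k.1 : Site (F.P K) 0 → Matrix.specialUnitaryGroup (Fin 2) ℂ) = fun _ => c := by
  have hι := iterCentralBond_injective (P := F.P K) hk
  constructor
  · intro h
    obtain ⟨h2, hoff⟩ := (pivotAct_eq_self_iff F hJK (iterCentralBond (P := F.P K) (K - J)) hι k z).1 h
    refine ⟨h2, ?_⟩
    obtain ⟨c, hc, hres, hact⟩ := exists_central_isResidual_of_residual F hJK ((mem_residualSubgroup_iff F hJK).1 k.1.2)
    refine ⟨c, hc, ?_⟩
    -- the rooted factor `c⁻¹ · w` fixes `z` on the comb bonds (none of which is a pivot), hence is `1`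
    have hone := eq_one_of_isResidual_of_gaugeAct_eq_on_combSet (P := F.P K) hk hres (U := z) fun b hb => by
      rw [hact z]
      exact hoff b fun ⟨c', hc'⟩ => iterCentralBond_not_mem_combSet hk c' (hc' ▸ hb)
    funext x
    have hx := congrFun hone x
    simp only [Pi.mul_apply] at hx
    exact (inv_mul_eq_one.1 hx).symm
  · rintro ⟨h2, c, hc, hk1⟩
    refine (pivotAct_eq_self_iff F hJK (iterCentralBond (P := F.P K) (K - J)) hι k z).2 ⟨h2, fun b _ => ?_⟩
    rw [hk1, gaugeAct_const_of_comm hc z]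

end Summit.QuantumFields.YangMills.Theorems.FluctuationComparisonRegPrIntLS2BetaPivotStabiliser

end
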